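import Mathlib
import Summits.CriticalPhenomena.SAWScalingLimit.Theorems.SAWRestrictionRigidityAxiomsOfLimitMarkovPathKernel
import HarnessLib

/-!
# The soft Markov theorem on path space (soft-Markov brick E2a)

Crux `AxiomsOfLimit` (stmt-CriticalPhenomena-1370), line `registered`, stub `stub_markovOfLimit`,
soft-Markov theorem on path space (E2a): "the strong Markov property of ANY random planar path at ALL
hitting times of closed sets, with one `F`-independent kernel" (lead c4). Theorems only.

On the path space `C([0,1], ℂ)` let `μ` be a finite measure whose paths start a.e. at a fixed point
`a`. For a closed set `F` write `τ_F` for the hitting parameter of `F`, `ω^t` for the path stopped at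
`t` and `X_F ω := (τ_F ω, ω^{τ_F})` for the pair (hitting time, path stopped at the hitting time).

* `comap_stop_mono` — `σ(ω^s) ≤ σ(ω^t)` for `s ≤ t` (stopping is transitive, `comp_stop_of_le`).
* `exists_pathFiltration` — the canonical filtration `𝔽 t = σ(ω^t)` of path space exists as a
  `MeasureTheory.Filtration ℝ`.
* `measure_setOf_pair_mem_eq_lintegral_condDistrib` — disintegration of the law of `(X, ω)` along any
  measurable `X` through the regular conditional distribution `condDistrib id X μ`
  (`compProd_map_condDistrib` + `Measure.compProd_apply` + `lintegral_map`).
* `softMarkov_pathLevel` / `stub_softMarkovPathLevel` — combining this with the one kernel for all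
  hitting times (`exists_pathKernel`, p162310): there is ONE map
  `K : ℝ × C([0,1], ℂ) → Measure C([0,1], ℂ)` such that for EVERY closed `F ∌ a` and every measurable
  `E ⊆ (ℝ × C([0,1], ℂ)) × C([0,1], ℂ)`,
  `μ {ω | (X_F ω, ω) ∈ E} = ∫⁻ ω, K (X_F ω) {y | (X_F ω, y) ∈ E} ∂μ`.

This is the strong Markov property at announceable (hitting) times with Knight's prediction process as
the kernel: F. B. Knight, *A predictive view of continuous time processes*, Ann. Probab. 3 (1975);
C. Dellacherie, P.-A. Meyer, *Probabilités et potentiel* B, VI.43–45; O. Kallenberg, *Foundations of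
Modern Probability* (2002), Thm. 6.3–6.4. All [folklore].
-/

noncomputable section

open MeasureTheory ProbabilityTheory Filter Topology Set

namespace Summit.CriticalPhenomena.SAWScalingLimit.Theorems.AxiomsOfLimitMarkov

open Literature.Probability.RandomPlanarGeometry

/-- The path `ω` stopped at real time `t`: `u ↦ ω (min u (projIcc t))`. [folklore] -/
local notation3 "stp[" t ", " ω "]" =>
  ContinuousMap.comp ω (ContinuousMap.id unitInterval ⊓
    ContinuousMap.const unitInterval (Set.projIcc (0:ℝ) 1 zero_le_one t))

/-- The hitting parameter of `F` by the path `ω`. [folklore] -/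
local notation3 "hit[" F ", " ω "]" => Curve.hitParam F (Curve.mk ω)

section PathSpace

variable [MeasurableSpace C(unitInterval, ℂ)] [BorelSpace C(unitInterval, ℂ)]

/-- The σ-algebras of the stopped paths increase: for `s ≤ t` the path stopped at `s` is the path
stopped at `t`, stopped again at `s` (`comp_stop_of_le`), hence `σ(ω^s) ≤ σ(ω^t)`. [folklore] -/
theorem comap_stop_mono {s t : ℝ} (hst : s ≤ t) :
    MeasurableSpace.comap (fun ω : C(unitInterval, ℂ) => stp[s, ω])
        (inferInstance : MeasurableSpace C(unitInterval, ℂ)) ≤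
      MeasurableSpace.comap (fun ω : C(unitInterval, ℂ) => stp[t, ω]) inferInstance := by
  have h : (fun ω : C(unitInterval, ℂ) => stp[s, ω]) =
      (fun ω : C(unitInterval, ℂ) => stp[s, ω]) ∘ fun ω : C(unitInterval, ℂ) => stp[t, ω] := by
    funext ω
    exact (comp_stop_of_le (Set.monotone_projIcc zero_le_one hst) ω).symm
  rw [h, ← MeasurableSpace.comap_comp]
  exact MeasurableSpace.comap_mono (measurable_stop _).comap_le

/-- **The canonical filtration of path space.** `t ↦ σ(path stopped at t)` is a filtration of the
Borel σ-algebra of `C([0,1], ℂ)` indexed by real time (monotone by `comap_stop_mono`, dominated by the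
Borel σ-algebra since stopping is continuous). [folklore] -/
theorem exists_pathFiltration :
    ∃ 𝔽 : Filtration ℝ (inferInstance : MeasurableSpace C(unitInterval, ℂ)), ∀ t : ℝ,
      𝔽 t = MeasurableSpace.comap (fun ω : C(unitInterval, ℂ) => stp[t, ω]) inferInstance :=
  ⟨⟨fun t => MeasurableSpace.comap (fun ω : C(unitInterval, ℂ) => stp[t, ω]) inferInstance,
    fun _ _ hst => comap_stop_mono hst, fun _ => (measurable_stop _).comap_le⟩, fun _ => rfl⟩

/-- **Disintegration along a statistic.** For a finite measure `μ` on path space and a measurable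
`X` into any measurable space, the joint law of `(X, path)` disintegrates through the regular
conditional distribution of the path given `X`:
`μ {ω | (X ω, ω) ∈ E} = ∫⁻ ω, condDistrib id X μ (X ω) {y | (X ω, y) ∈ E} ∂μ`
(`compProd_map_condDistrib`, `Measure.compProd_apply`, `lintegral_map`). [folklore] -/
theorem measure_setOf_pair_mem_eq_lintegral_condDistrib {β : Type*} [MeasurableSpace β]
    (μ : Measure C(unitInterval, ℂ)) [IsFiniteMeasure μ] {X : C(unitInterval, ℂ) → β}
    (hX : Measurable X) {E : Set (β × C(unitInterval, ℂ))} (hE : MeasurableSet E) :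
    μ {ω | (X ω, ω) ∈ E} = ∫⁻ ω, condDistrib id X μ (X ω) {y | (X ω, y) ∈ E} ∂μ := by
  have h1 : μ.map (fun ω => (X ω, id ω)) = (μ.map X) ⊗ₘ condDistrib id X μ :=
    (compProd_map_condDistrib aemeasurable_id).symm
  calc μ {ω | (X ω, ω) ∈ E}
      = μ.map (fun ω => (X ω, id ω)) E := (Measure.map_apply (hX.prodMk measurable_id) hE).symm
    _ = ((μ.map X) ⊗ₘ condDistrib id X μ) E := by rw [h1]
    _ = ∫⁻ x, condDistrib id X μ x (Prod.mk x ⁻¹' E) ∂(μ.map X) := Measure.compProd_apply hE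
    _ = ∫⁻ ω, condDistrib id X μ (X ω) (Prod.mk (X ω) ⁻¹' E) ∂μ :=
        lintegral_map (Kernel.measurable_kernel_prodMk_left hE) hX
    _ = ∫⁻ ω, condDistrib id X μ (X ω) {y | (X ω, y) ∈ E} ∂μ := rfl

/-- **The soft Markov theorem on path space (brick E2a).** For a finite measure on `C([0,1], ℂ)`
whose paths start a.e. at `a`, there is ONE map `K : ℝ × C([0,1], ℂ) → Measure C([0,1], ℂ)` which
disintegrates the law of the whole path along `X_F = (τ_F, ω^{τ_F})` for EVERY closed `F ∌ a` at
once: `μ {ω | (X_F ω, ω) ∈ E} = ∫⁻ ω, K (X_F ω) {y | (X_F ω, y) ∈ E} ∂μ` — the strong Markov property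
at all hitting times of closed sets with an `F`-independent kernel (`exists_pathKernel` for the
canonical filtration `exists_pathFiltration`, read through
`measure_setOf_pair_mem_eq_lintegral_condDistrib`). [folklore] -/
theorem softMarkov_pathLevel (μ : Measure C(unitInterval, ℂ)) [IsFiniteMeasure μ] {a : ℂ}
    (ha : ∀ᵐ ω ∂μ, ω 0 = a) :
    ∃ K : ℝ × C(unitInterval, ℂ) → Measure C(unitInterval, ℂ), ∀ F : Set ℂ, IsClosed F → a ∉ F →
      ∀ E : Set ((ℝ × C(unitInterval, ℂ)) × C(unitInterval, ℂ)), MeasurableSet E →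
        μ {ω : C(unitInterval, ℂ) | ((hit[F, ω], stp[hit[F, ω], ω]), ω) ∈ E} =
          ∫⁻ ω, K (hit[F, ω], stp[hit[F, ω], ω])
            {y : C(unitInterval, ℂ) | ((hit[F, ω], stp[hit[F, ω], ω]), y) ∈ E} ∂μ := by
  obtain ⟨𝔽, h𝔽⟩ := exists_pathFiltration
  obtain ⟨K, hK⟩ := exists_pathKernel 𝔽 h𝔽 μ ha
  refine ⟨K, fun F hF haF E hE => ?_⟩
  have hX : Measurable fun ω : C(unitInterval, ℂ) => (hit[F, ω], stp[hit[F, ω], ω]) :=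
    (Curve.measurable_hitParam_mk hF).prodMk (measurable_stop_random (Curve.measurable_hitParam_mk hF))
  refine (measure_setOf_pair_mem_eq_lintegral_condDistrib μ hX hE).trans (lintegral_congr_ae ?_)
  filter_upwards [hK F hF haF] with ω hω
  exact congrArg (fun ν : Measure C(unitInterval, ℂ) =>
    ν {y : C(unitInterval, ℂ) | ((hit[F, ω], stp[hit[F, ω], ω]), y) ∈ E}) hω

end PathSpace

/-! ### Registered sub-goal of crux stmt-CriticalPhenomena-1370 (line `registered`, stub `stub_markovOfLimit`) -/

section Registered

/-- **Registered sub-goal `stub_softMarkovPathLevel`** (crux stmt-CriticalPhenomena-1370, soft-Markov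
line, brick E2a): `softMarkov_pathLevel` with all binders explicit and notation-free — for every finite
measure on `C([0,1], ℂ)` with a.e. starting point `a` there is one map
`K : ℝ × C([0,1], ℂ) → Measure C([0,1], ℂ)` disintegrating the law of the path along
(hitting time of `F`, path stopped there), simultaneously for every closed `F ∌ a`. [folklore] -/
theorem stub_softMarkovPathLevel :
    ∀ [MeasurableSpace C(unitInterval, ℂ)] [BorelSpace C(unitInterval, ℂ)] (μ : MeasureTheory.Measure C(unitInterval, ℂ)) [MeasureTheory.IsFiniteMeasure μ] (a : ℂ), Filter.Eventually (fun ω : C(unitInterval, ℂ) => ω 0 = a) (MeasureTheory.ae μ) → ∃ K : ℝ × C(unitInterval, ℂ) → MeasureTheory.Measure C(unitInterval, ℂ), ∀ F : Set ℂ, IsClosed F → a ∉ F → ∀ E : Set ((ℝ × C(unitInterval, ℂ)) × C(unitInterval, ℂ)), MeasurableSet E → μ {ω : C(unitInterval, ℂ) | ((((Literature.Probability.RandomPlanarGeometry.Curve.mk (ω)).hitParam F), ((ω).comp (ContinuousMap.id unitInterval ⊓ ContinuousMap.const unitInterval (Set.projIcc (0:ℝ) 1 zero_le_one (((Literature.Probability.RandomPlanarGeometry.Curve.mk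 (ω)).hitParam F)))))), ω) ∈ E} = MeasureTheory.lintegral μ (fun ω : C(unitInterval, ℂ) => K (((Literature.Probability.RandomPlanarGeometry.Curve.mk (ω)).hitParam F), ((ω).comp (ContinuousMap.id unitInterval ⊓ ContinuousMap.const unitInterval (Set.projIcc (0:ℝ) 1 zero_le_one (((Literature.Probability.RandomPlanarGeometry.Curve.mk (ω)).hitParam F)))))) {y : C(unitInterval, ℂ) | ((((Literature.Probability.RandomPlanarGeometry.Curve.mk (ω)).hitParam F), ((ω).comp (ContinuousMap.id unitInterval ⊓ ContinuousMap.const unitInterval (Set.projIcc (0:ℝ) 1 zero_le_one (((Literature.Probability.RandomPlanarGeometry.Curve.mk (ω)).hitParam F)))))), y) ∈ E}) :=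
  fun μ _ _ ha => softMarkov_pathLevel μ ha

end Registered

end Summit.CriticalPhenomena.SAWScalingLimit.Theorems.AxiomsOfLimitMarkov

end
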